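/-
Copyright (c) 2026 the pub-hodgecm-mathlib formalisation cell (harness21).  Prover seat hodgecm-mathlib-K2E3-p14 (g2), Track B «K2-LIT» ∕ h413
(`stmt-HodgeConjecture-24833`), unit U12 «Harish-Chandra characters» of the line `K2_E3_EllipticInputs`, socket U12-h ‹#9L› `sig_K2E3CharLocConstNearRegular`:
package (P-U, generic column) for the 9L line lead's U-assembly ★ p855958 `exists_levelTraceStable_U` (K2E3-p09 (g2)), free-hand take K2 bus 2026-09-04T00:14Z.  2026-09-04.
-/
import Summits.HodgeConjecture.HodgeConjecture.Theorems.K2E3UnitaryCongruenceFiltration     -- ★ p855816 (this seat): the subgroup frame `Kf m := (congruenceGL n |ϖ|^m).comap (U.subtype.comp e)`; brings ★ p855784, ★ part 1 p855729, ★ p855559 (C), ★ p855532 (H-char), ★ `GLnCongruenceSubgroups`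
import Summits.HodgeConjecture.HodgeConjecture.Theorems.K2E3LocalFieldNormDictionary        -- ★ p855923∕p855949 (K2E1b-p01): `norm_conj_eq_of_norm_le_one`; brings ★ p855727 `norm_conj_sub_le_of_le` (hA)
import HarnessLib

/-!
# Crux `H413` — K2-LIT E3 «EllipticInputs», U12-h package (P-U, generic column): THE S-INDEPENDENT PARAMETER BINDERS OF ★ p855958 `exists_levelTraceStable_U`
# ALONG A SUBGROUP FRAME `e : G ≃ₜ* ↥U` (`U ≤ GL_n(F)`) — `hnd` (one-sided), `hconjCh`, `hiso` (on `Kf 0`), `hcontr` (every `ν`), `hδm`, in their EXACT shapes, from the ★ GL bricks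
# (H-char)∕(hA)∕(Dict) and three dictionary clauses taken as hypotheses

Cell `hodgecm-mathlib`, Track B «K2-LIT», crux item `stmt-HodgeConjecture-24833` (h413), line `K2_E3_EllipticInputs`, unit U12 «HC characters», socket U12-h
`sig_K2E3CharLocConstNearRegular` (‹#9L›).  The 9L line lead's U-assembly ★ p855958 `K2E3LevelTraceStableAtPlaceU.exists_levelTraceStable_U` (the `hstab` of ★ p855210 at a SUBGROUP frame
`e : G ≃ₜ* ↥U`, `U ≤ GL_n(F)` closed — the one-place model `localNonsplitEquiv` at a non-split place) takes, besides the `S`-specific bricks hSAd∕hS∕hint∕hocc (`S = 𝔲`, K2E1b-p08's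
(Char-U)∕(N-U)), the `S`-INDEPENDENT parameter binders hnd, hconjCh, hiso, hcontr, hδm (and hval = ★ (Dict) `exists_ne_zero_and_norm_eq`).  THIS FILE delivers those five in the EXACT binder
shapes of ★ p855958 (levels `Kf m := (congruenceGL n (valuation F ϖ ^ m)).comap (U.subtype.comp e.toMulEquiv.toMonoidHom)` of ★ p855784∕p855816, matrices read as
`(((e x : U) : GL (Fin n) F) : Matrix (Fin n) (Fin n) F)`), for `Ch` pinned only by its defining equation `hCh : Ch X g = ((ψ (tr (X * (↑↑(e g) − 1)))) : Circle) : ℂ)` and with the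
(Dict) clauses `hdict ∕ hint1 ∕ hlev` as hypotheses (★ `clause_hdict ∕ clause_hint1 ∕ clause_hlev` at `q := ‖ϖ‖⁻¹`, any convention) — the twin of ★ p855953 (P-GL) for the non-split column.
`--supports stmt-HodgeConjecture-24833 --as helper`.  THEOREMS ONLY — no `def`, no named fact, no instance, no notation, no `sorry`.  HONEST LABEL: HC_CM is proved only modulo the 7 printed
citations (2 remaining named inputs: hLiu418 = stmt-HodgeConjecture-24832, h413 = stmt-HodgeConjecture-24833) until rung 0 closes; count-neutral plumbing.

* `paramU_hconjCh` — exact equivariance `Ch X (x⁻¹ a x) = Ch ((e x) X (e x)⁻¹) a` (★ (H-char) `map_trace_mul_coe_conj_sub_one`; no norm).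
* `paramU_hnd` — `‖X‖ ≤ q^m ⇒ Ch X ≡ 1 on Kf m` (★ (H-char) `map_trace_mul_coe_sub_one_eq_one` + `hdict`).
* `paramU_hiso` — `‖(e x) X (e x)⁻¹‖ = ‖X‖` on `Kf 0` (★ (Dict) `norm_conj_eq_of_norm_le_one` + `hint1`) · `paramU_hcontr` — `‖(e x) X (e x)⁻¹ − X‖ ≤ (q^ν)⁻¹ ‖X‖` on `Kf ν`, every `ν`
  (★ (hA) `norm_conj_sub_le_of_le` + `hlev` + `hint1`) · `paramU_hδm` — for `δ > 0` some `Kf m` has `‖e t − 1‖ < δ`, `‖(e t)⁻¹‖ ≤ 1` (`hlev`, `hint1`, `(q^m)⁻¹ → 0` as `1 < q`).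

## References
* [HarishChandra1999] Harish-Chandra (DeBacker–Sally), *Admissible Invariant Distributions on Reductive p-adic Groups*, ULECT 16 (1999), §17 pp. 80–81, §19 pp. 84–86.
* [Howe1977Kirillov] R. Howe, *Kirillov theory for compact p-adic groups*, Pacific J. Math. 73 (1977), §1.
* [BushnellHenniart2006] C. J. Bushnell, G. Henniart, *The Local Langlands Conjecture for GL(2)*, Grundlehren 335 (2006), §1.1.
-/

set_option autoImplicit false
-- the mandated namespace repeats `HodgeConjecture.HodgeConjecture`, as in every `Theorems/*.lean` of this sub-problem
set_option linter.dupNamespace false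

noncomputable section

open Topology Filter Set ValuativeRel Matrix
open Literature.NumberTheory.Automorphic Literature.Analysis.Matrix
open Summit.HodgeConjecture.HodgeConjecture.Cruxes.H413 Summit.HodgeConjecture.HodgeConjecture.Cruxes.H413.K2E3UnitaryCongruenceFrame
open scoped MatrixGroups Matrix.Norms.Elementwise

namespace Summit.HodgeConjecture.HodgeConjecture.Cruxes.H413.K2E3ParameterPackageU

/-! ## §1 `hconjCh` (no norm) -/

section Algebra

variable {F : Type*} [Field F] [TopologicalSpace F] {n : ℕ} {U : Subgroup (GL (Fin n) F)} {G : Type*} [Group G] [TopologicalSpace G] (e : G ≃ₜ* U)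
  {M : Type*} [CommMonoid M] (ψ : AddChar F M)

/-- **`hconjCh` (★ p855958's shape)**: with `Ch X g = ι (ψ (tr (X * (↑↑(e g) − 1))))`, `Ch X (x⁻¹ a x) = Ch ((e x) X (e x)⁻¹) a` for ALL `x a : G` (★ (H-char)
`map_trace_mul_coe_conj_sub_one` at `κ := (↑(e x))⁻¹`, `k := ↑(e a)`). [cite: Howe1977Kirillov, §1] [cite: HarishChandra1999, §17 p. 81] -/
theorem paramU_hconjCh {T : Type*} (ι : M → T) (Ch : Matrix (Fin n) (Fin n) F → G → T)
    (hCh : ∀ (X : Matrix (Fin n) (Fin n) F) (g : G), Ch X g = ι (ψ (Matrix.trace (X * ((((e g : U) : GL (Fin n) F) : Matrix (Fin n) (Fin n) F) - 1))))) :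
    ∀ (x : G) (X : Matrix (Fin n) (Fin n) F) (a : G),
      Ch X (x⁻¹ * a * x) = Ch ((((e x : U) : GL (Fin n) F) : Matrix (Fin n) (Fin n) F) * X * ((((e x : U) : GL (Fin n) F)⁻¹ : GL (Fin n) F) : Matrix (Fin n) (Fin n) F)) a := by
  intro x X a
  rw [hCh, hCh, map_mul, map_mul, map_inv, Subgroup.coe_mul, Subgroup.coe_mul, Subgroup.coe_inv]
  have h := K2E3CongruenceLayerCharactersGL.map_trace_mul_coe_conj_sub_one ψ X ((e x : U) : GL (Fin n) F)⁻¹ ((e a : U) : GL (Fin n) F)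
  rw [inv_inv] at h
  rw [h]

end Algebra

/-! ## §2 `hnd`, `hiso`, `hcontr`, `hδm` -/

section Normed

variable {F : Type*} [NontriviallyNormedField F] [ValuativeRel F] {n : ℕ} {U : Subgroup (GL (Fin n) F)} {G : Type*} [Group G] [TopologicalSpace G] (e : G ≃ₜ* U)
  {ϖ : F} {q : ℝ} (ψ : AddChar F Circle)

/-- **`hnd` (ONE-SIDED NON-DEGENERACY, ★ p855958's shape): `‖X‖ ≤ q^m ⇒ Ch X ≡ 1 on Kf m`** (`hdict` + ★ (H-char) `map_trace_mul_coe_sub_one_eq_one`; `1 ≤ m` carried unused).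
[cite: Howe1977Kirillov, §1] [cite: HarishChandra1999, §17 p. 80] -/
theorem paramU_hnd (hϖ : IsUniformizingElement ϖ) (hψ : ∀ x : F, valuation F x ≤ 1 → ψ x = 1)
    (hdict : ∀ (m : ℕ) (X : Matrix (Fin n) (Fin n) F), ValBound (valuation F ϖ ^ m)⁻¹ X ↔ ‖X‖ ≤ q ^ m)
    (Ch : Matrix (Fin n) (Fin n) F → G → ℂ)
    (hCh : ∀ (X : Matrix (Fin n) (Fin n) F) (g : G), Ch X g = ((ψ (Matrix.trace (X * ((((e g : U) : GL (Fin n) F) : Matrix (Fin n) (Fin n) F) - 1))) : Circle) : ℂ)) :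
    ∀ m : ℕ, 1 ≤ m → ∀ X : Matrix (Fin n) (Fin n) F, ‖X‖ ≤ q ^ m →
      ∀ a ∈ (congruenceGL n (valuation F ϖ ^ m)).comap (U.subtype.comp e.toMulEquiv.toMonoidHom), Ch X a = 1 := by
  intro m _ X hX a ha
  have ha' : ((e a : U) : GL (Fin n) F) ∈ congruenceGL n (valuation F ϖ ^ m) := (mem_comap_congruenceGL_iff e _ a).1 ha
  have hXv : ValBound (valuation F ϖ ^ m)⁻¹ X := (hdict m X).2 hX
  have hle : (valuation F ϖ ^ m)⁻¹ * valuation F ϖ ^ m ≤ 1 :=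
    (inv_mul_cancel₀ (pow_ne_zero _ ((Valuation.ne_zero_iff _).2 hϖ.ne_zero))).le
  have h1 := K2E3CongruenceLayerCharactersGL.map_trace_mul_coe_sub_one_eq_one ψ hψ hle hXv ha'
  rw [hCh]
  exact (congrArg (fun z : Circle => (z : ℂ)) h1).trans Circle.coe_one

variable [IsUltrametricDist F]

/-- **`hiso` (★ p855958's shape, on `Kf 0`)**: `‖(e x) X (e x)⁻¹‖ = ‖X‖` for `x ∈ Kf 0` (`K_{|ϖ|^0} ≤ GL_n(𝒪)`; ★ (Dict) `norm_conj_eq_of_norm_le_one` + `hint1`).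
[cite: HarishChandra1999, §17 p. 80] -/
theorem paramU_hiso (hint1 : ∀ k : GL (Fin n) F, k ∈ glInt n F → ‖(k : Matrix (Fin n) (Fin n) F)‖ ≤ 1) :
    ∀ x ∈ (congruenceGL n (valuation F ϖ ^ 0)).comap (U.subtype.comp e.toMulEquiv.toMonoidHom), ∀ X : Matrix (Fin n) (Fin n) F,
      ‖(((e x : U) : GL (Fin n) F) : Matrix (Fin n) (Fin n) F) * X * ((((e x : U) : GL (Fin n) F)⁻¹ : GL (Fin n) F) : Matrix (Fin n) (Fin n) F)‖ = ‖X‖ := by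
  intro x hx X
  have hx' : ((e x : U) : GL (Fin n) F) ∈ glInt n F := congruenceGL_le_glInt _ ((mem_comap_congruenceGL_iff e _ x).1 hx)
  exact K2E3LocalFieldNormDictionary.norm_conj_eq_of_norm_le_one _ (hint1 _ hx') (hint1 _ (Subgroup.inv_mem _ hx')) X

/-- **`hcontr` (★ p855958's shape, every `ν`)**: `‖(e x) X (e x)⁻¹ − X‖ ≤ (q^ν)⁻¹ ‖X‖` for `x ∈ Kf ν` (★ (hA) `norm_conj_sub_le_of_le` + `hlev` + `hint1`).
[cite: HarishChandra1999, §17 p. 80] [cite: BushnellHenniart2006, §1.1] -/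
theorem paramU_hcontr (hint1 : ∀ k : GL (Fin n) F, k ∈ glInt n F → ‖(k : Matrix (Fin n) (Fin n) F)‖ ≤ 1)
    (hlev : ∀ (m : ℕ) (k : GL (Fin n) F), k ∈ congruenceGL n (valuation F ϖ ^ m) → ‖(k : Matrix (Fin n) (Fin n) F) - 1‖ ≤ (q ^ m)⁻¹) :
    ∀ ν : ℕ, ∀ x ∈ (congruenceGL n (valuation F ϖ ^ ν)).comap (U.subtype.comp e.toMulEquiv.toMonoidHom), ∀ X : Matrix (Fin n) (Fin n) F,
      ‖(((e x : U) : GL (Fin n) F) : Matrix (Fin n) (Fin n) F) * X * ((((e x : U) : GL (Fin n) F)⁻¹ : GL (Fin n) F) : Matrix (Fin n) (Fin n) F) - X‖ ≤ (q ^ ν)⁻¹ * ‖X‖ := by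
  intro ν x hx X
  have hx' : ((e x : U) : GL (Fin n) F) ∈ congruenceGL n (valuation F ϖ ^ ν) := (mem_comap_congruenceGL_iff e _ x).1 hx
  exact K2E3RegularAdjointConeEstimates.norm_conj_sub_le_of_le _ (hlev ν _ hx') (hint1 _ (Subgroup.inv_mem _ (congruenceGL_le_glInt _ hx'))) X

omit [IsUltrametricDist F] in
/-- **`hδm` (★ p855958's shape)**: for every `δ > 0` some level `Kf m` has `‖e t − 1‖ < δ` and `‖(e t)⁻¹‖ ≤ 1` on it (`hlev`: `‖e t − 1‖ ≤ (q^m)⁻¹`; `1 < q` ⇒ `(q^m)⁻¹ → 0`; `hint1` for the inverse).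
[cite: HarishChandra1999, §17 p. 80] -/
theorem paramU_hδm (hq : 1 < q) (hint1 : ∀ k : GL (Fin n) F, k ∈ glInt n F → ‖(k : Matrix (Fin n) (Fin n) F)‖ ≤ 1)
    (hlev : ∀ (m : ℕ) (k : GL (Fin n) F), k ∈ congruenceGL n (valuation F ϖ ^ m) → ‖(k : Matrix (Fin n) (Fin n) F) - 1‖ ≤ (q ^ m)⁻¹) :
    ∀ δ : ℝ, 0 < δ → ∃ m : ℕ, ∀ t ∈ (congruenceGL n (valuation F ϖ ^ m)).comap (U.subtype.comp e.toMulEquiv.toMonoidHom),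
      ‖(((e t : U) : GL (Fin n) F) : Matrix (Fin n) (Fin n) F) - 1‖ < δ ∧ ‖((((e t : U) : GL (Fin n) F)⁻¹ : GL (Fin n) F) : Matrix (Fin n) (Fin n) F)‖ ≤ 1 := by
  intro δ hδ
  have hq0 : 0 < q := zero_lt_one.trans hq
  obtain ⟨m, hm⟩ := exists_pow_lt_of_lt_one hδ (inv_lt_one_of_one_lt₀ hq)
  refine ⟨m, fun t ht => ?_⟩
  have ht' : ((e t : U) : GL (Fin n) F) ∈ congruenceGL n (valuation F ϖ ^ m) := (mem_comap_congruenceGL_iff e _ t).1 ht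
  refine ⟨(hlev m _ ht').trans_lt (by rwa [← inv_pow]), hint1 _ (Subgroup.inv_mem _ (congruenceGL_le_glInt _ ht'))⟩

end Normed

end Summit.HodgeConjecture.HodgeConjecture.Cruxes.H413.K2E3ParameterPackageU

end
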